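import Summits.AtomisticToContinuum.Crystallization.Theorems.ReggeStarCoercivityDefectFreeCrystallizesSiteColumnLJ
import Summits.AtomisticToContinuum.Crystallization.Theorems.PalmUnimodularRigidityLayeredLawsSelectHcpUniqueMinimiser
import Summits.AtomisticToContinuum.Crystallization.Theorems.PalmUnimodularRigidityLayeredLawsSelectHcpMinimiserEnclosure
import Summits.AtomisticToContinuum.Crystallization.Theorems.PalmUnimodularRigidityLayeredLawsSelectHcpSelectionWord
import Summits.AtomisticToContinuum.Crystallization.Theorems.PalmUnimodularRigidityCruxesToPalmRigidity
import Summits.AtomisticToContinuum.Crystallization.Theorems.SquareWellLayerCakeStackingFaultSparsityFarPasteLattice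
import Literature.Probability.Process.PointStationaryLaw

/-!
# Selection at exact geometry (stub `stub_exactSelectionLaw`, X3 of line `palm-good-law`, crux
# `ReggeStarCoercivity.DefectFreeCrystallizes`, stmt-AtomisticToContinuum-13603)

Let `(a₀, h₀)` be the relaxed hcp reference (the box `[0.945, 0.995] × [0.77, 0.815]` and global
minimality of `hcpE`), and let `P` be a point-stationary probability law on rooted `δ`-hard-core
configurations of `ℝ³` which is a.s. the counting measure of a rotated EXACT Barlow stacking
`A '' barlowStacking a₀ h s`, `h ∈ {h₀, a₀ √(2/3)}`, `s` a Hägg word, with mean root energy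
`E_P[½ ∫ V_LJ(‖y‖) dμ(y)] ≤ hcpE a₀ h₀`.  Then a.s. `μ = count|(A' '' hcpStacking a₀ h₀)`
(`stub_exactSelectionLaw`).  Steps:

* ROOT ENERGY IDENTITY (`rootEnergy_reroot_eq_barlowSiteEnergy`): the configuration
  `count|(A '' barlowStacking a h s)` re-rooted at its atom `A (barlowPos a h s k i j)` has root energy
  `barlowSiteEnergy lennardJones a h s k` (any word; `integral = tsum` over the countable carrier,
  rotation invariance, the `ℤ³` parametrisation, and the landed layer-by-layer regrouping
  `tsum_barlowPos_eq_two_mul_barlowSiteEnergy_of_word`).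
* COLUMN (`selection_at_site`): on the column box (reached from the minimiser enclosure
  `tube_minimiserEnclosure`, resp. `0.78 < √(2/3) < 0.85`) the landed column `SiteColumnLJ.stub_siteColumnLJ`
  gives `hcpE a₀ h + ½ (J₃ − J₂)([s (m+1) = s m] + [s (m−1) = s (m−2)]) ≤ barlowSiteEnergy … m` with
  `J₃ − J₂ > 0`; so `barlowSiteEnergy … m ≤ hcpE a₀ h₀ ≤ hcpE a₀ h` forces `hcpE a₀ h = hcpE a₀ h₀`, i.e.
  `h = h₀` (`tube_hcpE_unique_minimiser`), and no cubic layer next to `m`.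
* THE LEVEL IS NOT JUNK (`hcpE_neg_of_isMin`, `ae_eq_const_of_integral_le`): `hcpE a₀ h₀ < 0`, so the
  mean root energy is a genuine integral and the a.s. floor `≥ hcpE a₀ h₀` plus the mean ceiling force
  a.s. equality.
* EVERY POINT (Aldous–Lyons, `ae_forall_map_sub_of_ae`): a.s. the root energy of the configuration
  re-rooted at every atom is `hcpE a₀ h₀`; at the atom `A (barlowPos a₀ h₀ s k 0 0)` this is the site
  energy of layer `k`, so no layer is cubic, `s = ± alternatingHagg`, and the sign is absorbed by the
  point reflection (`bijOn_neg_hcpStacking`).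

All `[folklore]`.
-/

noncomputable section

namespace Summit.AtomisticToContinuum.Crystallization.Theorems.PalmGoodLaw.ExactSelectionLaw

open MeasureTheory Set
open Literature.MathematicalPhysics.StatisticalMechanics Literature.Probability.Process
open Summit.AtomisticToContinuum.Crystallization.Theorems.PalmUnimodularRigidity.LayeredLawsSelectHcp
  (hcpE hcpE_eq_hcpSumS hcpSumS_pos' tube_hcpE_unique_minimiser tube_minimiserEnclosure
    eq_alternating_or_neg_of_forall bijOn_neg_hcpStacking)
open Summit.AtomisticToContinuum.Crystallization.Theorems.ExcessDecayLiouvilleCoarseGrains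
  (hcpSumS hcpPinC_dilation_value)
open Summit.AtomisticToContinuum.Crystallization.Theorems.SquareWellLayerCake.StackingFaultSparsity
  (summable_lennardJones_barlowPos_of_word tsum_barlowPos_shift
    tsum_barlowPos_eq_two_mul_barlowSiteEnergy_of_word)

/-! ## The root energy of a rotated exact stacking, re-rooted at an atom -/

/-- Sums over an injective image of a Barlow stacking (`a, h > 0`) are sums over the parameter
lattice `ℤ³` (the parametrisation `barlowPos` is a bijection onto the stacking). [folklore] -/
theorem summable_and_tsum_image_barlowStacking {a h : ℝ} (ha : 0 < a) (hh : 0 < h) (s : ℤ → ℤ)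
    {Φ : EuclideanSpace ℝ (Fin 3) → EuclideanSpace ℝ (Fin 3)} (hΦ : Function.Injective Φ)
    (F : EuclideanSpace ℝ (Fin 3) → ℝ) :
    ((Summable fun t : ↥(Φ '' barlowStacking a h s) => F t) ↔
        Summable fun q : ℤ × ℤ × ℤ => F (Φ (barlowPos a h s q.1 q.2.1 q.2.2))) ∧
      ∑' t : ↥(Φ '' barlowStacking a h s), F t =
        ∑' q : ℤ × ℤ × ℤ, F (Φ (barlowPos a h s q.1 q.2.1 q.2.2)) := by
  set e₀ : ℤ × ℤ × ℤ → ↥(Φ '' barlowStacking a h s) := fun q =>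
    ⟨Φ (barlowPos a h s q.1 q.2.1 q.2.2), Set.mem_image_of_mem Φ (barlowPos_mem _ _ _)⟩ with he₀
  have hbij : Function.Bijective e₀ := by
    refine ⟨fun q q' hqq' => barlowPos_injective ha hh s (hΦ (congrArg Subtype.val hqq')), ?_⟩
    rintro ⟨_, _, ⟨k, i, j, rfl⟩, rfl⟩
    exact ⟨(k, i, j), rfl⟩
  set e := Equiv.ofBijective e₀ hbij with he
  exact ⟨(e.summable_iff (f := fun t : ↥(Φ '' barlowStacking a h s) => F t)).symm,
    (e.tsum_eq fun t : ↥(Φ '' barlowStacking a h s) => F t).symm⟩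

/-- **Root energy identity.** For a linear isometry `A`, spacings `a, h > 0` and ANY word `s`, the
configuration `count|(A '' barlowStacking a h s)` re-rooted at its atom `A (barlowPos a h s k i j)` has
root energy `½ ∫ V_LJ(‖z‖) = barlowSiteEnergy lennardJones a h s k`: the carrier is the injective image
of the stacking under `z ↦ A z − A p`, `‖A z − A p‖ = dist p z`, the Lennard-Jones sum over the stacking
seen from `p` is absolutely summable in the `ℤ³` parametrisation, so the Bochner integral against the
counting measure is the `tsum`, which is `2 · barlowSiteEnergy` by in-layer translation invariance and
the landed layer-by-layer regrouping. [folklore] -/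
theorem rootEnergy_reroot_eq_barlowSiteEnergy {a h : ℝ} (ha : 0 < a) (hh : 0 < h) (s : ℤ → ℤ)
    (A : EuclideanSpace ℝ (Fin 3) ≃ₗᵢ[ℝ] EuclideanSpace ℝ (Fin 3)) (k i j : ℤ) :
    (∫ z, lennardJones ‖z‖ ∂(Measure.count : Measure (EuclideanSpace ℝ (Fin 3))).restrict
        ((fun z => z - A (barlowPos a h s k i j)) '' (A '' barlowStacking a h s))) / 2 =
      barlowSiteEnergy lennardJones a h s k := by
  set p := barlowPos a h s k i j with hp
  have himg : (fun z => z - A p) '' (A '' barlowStacking a h s) =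
      (fun z => A z - A p) '' barlowStacking a h s := Set.image_image _ _ _
  have hΦ : Function.Injective fun z => A z - A p := fun z z' hzz' =>
    A.injective (sub_left_injective hzz')
  set T := (fun z => A z - A p) '' barlowStacking a h s with hT
  have hcount : T.Countable := by
    refine (Set.Countable.mono ?_ (Set.countable_range
      fun q : ℤ × ℤ × ℤ => barlowPos a h s q.1 q.2.1 q.2.2)).image _
    rintro _ ⟨k', i', j', rfl⟩
    exact ⟨(k', i', j'), rfl⟩
  have hnorm : ∀ q : ℤ × ℤ × ℤ, ‖A (barlowPos a h s q.1 q.2.1 q.2.2) - A p‖ =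
      dist p (barlowPos a h s q.1 q.2.1 q.2.2) := fun q => by
    rw [← map_sub, LinearIsometryEquiv.norm_map, dist_comm, dist_eq_norm]
  obtain ⟨hiff, htsum⟩ :=
    summable_and_tsum_image_barlowStacking ha hh s hΦ fun z => lennardJones ‖z‖
  have hsum : Summable fun t : T => lennardJones ‖(t : EuclideanSpace ℝ (Fin 3))‖ := by
    refine hiff.2 ?_
    simp only [hnorm]
    exact summable_lennardJones_barlowPos_of_word ha hh s k i j
  -- the Bochner integral against `count|T` is the `tsum`
  have hmeas : Measurable fun z : EuclideanSpace ℝ (Fin 3) => lennardJones ‖z‖ := by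
    have hV : Measurable lennardJones := by
      show Measurable fun r : ℝ => (1 / 12) * (r⁻¹) ^ 12 - (1 / 6) * (r⁻¹) ^ 6
      exact ((measurable_inv.pow_const 12).const_mul _).sub
        ((measurable_inv.pow_const 6).const_mul _)
    exact hV.comp measurable_norm
  have hint : Integrable (fun z : EuclideanSpace ℝ (Fin 3) => lennardJones ‖z‖)
      ((Measure.count : Measure (EuclideanSpace ℝ (Fin 3))).restrict T) := by
    refine ⟨hmeas.aestronglyMeasurable, ?_⟩
    rw [hasFiniteIntegral_iff_enorm, lintegral_countable _ hcount]
    simp only [Measure.count_singleton, mul_one]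
    simp_rw [Real.enorm_eq_ofReal_abs]
    rw [← ENNReal.ofReal_tsum_of_nonneg (fun _ => abs_nonneg _) hsum.abs]
    exact ENNReal.ofReal_lt_top
  have hI : ∫ z, lennardJones ‖z‖ ∂(Measure.count : Measure (EuclideanSpace ℝ (Fin 3))).restrict T =
      ∑' t : T, lennardJones ‖(t : EuclideanSpace ℝ (Fin 3))‖ := by
    rw [setIntegral_countable _ hcount hint]
    refine tsum_congr fun z => ?_
    rw [measureReal_def, Measure.count_singleton, ENNReal.toReal_one, one_smul]
  rw [himg, hI, htsum]
  simp only [hnorm]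
  rw [tsum_barlowPos_shift s k i j lennardJones,
    tsum_barlowPos_eq_two_mul_barlowSiteEnergy_of_word ha hh s k]
  ring

/-- **Root energy identity at the root**: `½ ∫ V_LJ(‖z‖) d(count|(A '' barlowStacking a h s)) =
barlowSiteEnergy lennardJones a h s 0` (the root is the site `(0, 0, 0)`). [folklore] -/
theorem rootEnergy_eq_barlowSiteEnergy_zero {a h : ℝ} (ha : 0 < a) (hh : 0 < h) (s : ℤ → ℤ)
    (A : EuclideanSpace ℝ (Fin 3) ≃ₗᵢ[ℝ] EuclideanSpace ℝ (Fin 3)) :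
    (∫ z, lennardJones ‖z‖ ∂(Measure.count : Measure (EuclideanSpace ℝ (Fin 3))).restrict
        (A '' barlowStacking a h s)) / 2 =
      barlowSiteEnergy lennardJones a h s 0 := by
  have h0 : barlowPos a h s 0 0 0 = 0 := by simp [barlowPos]
  have h1 := rootEnergy_reroot_eq_barlowSiteEnergy ha hh s A 0 0 0
  rw [h0, map_zero] at h1
  simpa only [sub_zero, Set.image_id'] using h1

/-! ## The column: selection at a site -/

/-- The column box for the two admissible spacings: `h₀` sits in `[39a₀/50, 17a₀/20]` by the minimiser
enclosure `|a₀ − 0.97129|, |h₀ − 0.79294| ≤ 10⁻⁴`, and `a₀ √(2/3)` by `0.78 < √(2/3) < 0.85`. [folklore] -/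
theorem column_box {a₀ h₀ : ℝ} (ha₁ : 189 / 200 ≤ a₀) (ha₂ : a₀ ≤ 199 / 200) (hh₁ : 77 / 100 ≤ h₀)
    (hh₂ : h₀ ≤ 163 / 200) (hmin : ∀ a h : ℝ, 0 < a → 0 < h → hcpE a₀ h₀ ≤ hcpE a h)
    {h : ℝ} (hh : h = h₀ ∨ h = a₀ * Real.sqrt (2 / 3)) :
    0 < h ∧ 39 / 50 * a₀ ≤ h ∧ h ≤ 17 / 20 * a₀ := by
  have ha0 : 0 < a₀ := by linarith
  rcases hh with rfl | rfl
  · obtain ⟨hA, hH⟩ := tube_minimiserEnclosure a₀ h ha₁ ha₂ hh₁ hh₂ hmin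
    rw [abs_le] at hA hH
    exact ⟨by linarith, by linarith [hA.1, hA.2, hH.1, hH.2], by linarith [hA.1, hA.2, hH.1, hH.2]⟩
  · have h1 : (39 / 50 : ℝ) ≤ Real.sqrt (2 / 3) := Real.le_sqrt_of_sq_le (by norm_num)
    have h2 : Real.sqrt (2 / 3) ≤ 17 / 20 := Real.sqrt_le_iff.2 ⟨by norm_num, by norm_num⟩
    have h3 : 0 < Real.sqrt (2 / 3) := Real.sqrt_pos.2 (by norm_num)
    exact ⟨mul_pos ha0 h3, by nlinarith, by nlinarith⟩

/-- **Selection at a site.** If the site energy of layer `m` of `barlowStacking a₀ h s`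
(`h ∈ {h₀, a₀ √(2/3)}`, `s` a Hägg word) is `≤ hcpE a₀ h₀`, then `h = h₀` and neither neighbouring pair
of layers of `m` is cubic: the landed column gives
`hcpE a₀ h + ½ (J₃ − J₂)([s (m+1) = s m] + [s (m−1) = s (m−2)]) ≤ barlowSiteEnergy ≤ hcpE a₀ h₀ ≤ hcpE a₀ h`
with `J₃ − J₂ > 0`, whence both indicators vanish and `hcpE a₀ h = hcpE a₀ h₀`, so `h = h₀` by uniqueness
of the minimiser. [folklore] -/
theorem selection_at_site {a₀ h₀ : ℝ} (ha₁ : 189 / 200 ≤ a₀) (ha₂ : a₀ ≤ 199 / 200)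
    (hh₁ : 77 / 100 ≤ h₀) (hh₂ : h₀ ≤ 163 / 200)
    (hmin : ∀ a h : ℝ, 0 < a → 0 < h → hcpE a₀ h₀ ≤ hcpE a h)
    {h : ℝ} (hh : h = h₀ ∨ h = a₀ * Real.sqrt (2 / 3)) {s : ℤ → ℤ} (hs : IsHaggSeq s) (m : ℤ)
    (hE : barlowSiteEnergy lennardJones a₀ h s m ≤ hcpE a₀ h₀) :
    h = h₀ ∧ s (m + 1) ≠ s m ∧ s (m - 1) ≠ s (m - 2) := by
  have ha0 : 0 < a₀ := by linarith
  have hh0 : 0 < h₀ := by linarith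
  obtain ⟨hpos, hlo, hhi⟩ := column_box ha₁ ha₂ hh₁ hh₂ hmin hh
  obtain ⟨hJ, hcolumn⟩ :=
    SiteColumnLJ.stub_siteColumnLJ a₀ h (by linarith) (by linarith) hlo hhi
  have hc := hcolumn s hs m
  have hmin' := hmin a₀ h ha0 hpos
  set D := barlowCoupling lennardJones a₀ h 3 - barlowCoupling lennardJones a₀ h 2 with hD
  set I₁ : ℝ := if s (m + 1) = s m then 1 else 0 with hI₁
  set I₂ : ℝ := if s (m - 1) = s (m - 2) then 1 else 0 with hI₂
  have hI₁0 : 0 ≤ I₁ := by rw [hI₁]; split_ifs <;> norm_num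
  have hI₂0 : 0 ≤ I₂ := by rw [hI₂]; split_ifs <;> norm_num
  have hprod0 : 0 ≤ 1 / 2 * D * (I₁ + I₂) := mul_nonneg (by linarith) (by linarith)
  have hprod : 1 / 2 * D * (I₁ + I₂) ≤ 0 := by linarith
  have hI : I₁ + I₂ ≤ 0 := by
    by_contra hlt
    have : 0 < 1 / 2 * D * (I₁ + I₂) := mul_pos (by linarith) (lt_of_not_ge hlt)
    linarith
  have heq : hcpE a₀ h = hcpE a₀ h₀ := le_antisymm (by linarith) hmin'
  refine ⟨(tube_hcpE_unique_minimiser a₀ h₀ a₀ h ha0 hh0 ha0 hpos hmin heq).2, fun h1 => ?_,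
    fun h1 => ?_⟩
  · have : I₁ = 1 := by rw [hI₁, if_pos h1]
    linarith
  · have : I₂ = 1 := by rw [hI₂, if_pos h1]
    linarith

/-! ## The level is not junk -/

/-- **The hcp level is negative**: a global minimiser of `hcpE` lies below the optimally dilated hcp of
layer ratio `1`, whose energy is `−S₃(1)²/(24 S₆(1)) < 0`. [folklore] -/
theorem hcpE_neg_of_isMin {a₀ h₀ : ℝ} (hmin : ∀ a h : ℝ, 0 < a → 0 < h → hcpE a₀ h₀ ≤ hcpE a h) :
    hcpE a₀ h₀ < 0 := by
  have h3 := hcpSumS_pos' (le_refl 3) one_pos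
  have h6 := hcpSumS_pos' (by norm_num : 3 ≤ 6) one_pos
  have hq : 0 < hcpSumS 6 1 / hcpSumS 3 1 := div_pos h6 h3
  obtain ⟨b, hb0, hb6⟩ : ∃ b : ℝ, 0 < b ∧ b ^ 6 = hcpSumS 6 1 / hcpSumS 3 1 :=
    ⟨(hcpSumS 6 1 / hcpSumS 3 1) ^ ((6 : ℕ) : ℝ)⁻¹, Real.rpow_pos_of_pos hq _,
      Real.rpow_inv_natCast_pow hq.le (by norm_num)⟩
  have key := hmin b (b * 1) hb0 (by rw [mul_one]; exact hb0)
  rw [hcpE_eq_hcpSumS hb0.ne' one_ne_zero, hcpPinC_dilation_value h3 h6 hb6] at key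
  have hpos : 0 < hcpSumS 3 1 ^ 2 / (24 * hcpSumS 6 1) := by positivity
  linarith

/-- **A.s. floor plus mean ceiling at a negative level force a.s. equality.** If `c < 0`, `c ≤ f` a.s.
and `∫ f dP ≤ c` for a probability measure `P`, then `f = c` a.s. (the Bochner integral of a
non-integrable `f` would be `0 > c`, so `f` is integrable, and `∫ (f − c) ≤ 0` with `f − c ≥ 0` a.s.).
[folklore] -/
theorem ae_eq_const_of_integral_le {Ω : Type*} [MeasurableSpace Ω] {P : Measure Ω}
    [IsProbabilityMeasure P] {f : Ω → ℝ} {c : ℝ} (hc : c < 0) (hge : ∀ᵐ ω ∂P, c ≤ f ω)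
    (hint : ∫ ω, f ω ∂P ≤ c) : ∀ᵐ ω ∂P, f ω = c := by
  have hf : Integrable f P := by
    by_contra hnot
    rw [integral_undef hnot] at hint
    linarith
  have hg : 0 ≤ᵐ[P] fun ω => f ω - c := hge.mono fun ω hω => sub_nonneg.2 hω
  have hgi : Integrable (fun ω => f ω - c) P := hf.sub (integrable_const c)
  have h0 : ∫ ω, (f ω - c) ∂P = 0 := by
    refine le_antisymm ?_ (integral_nonneg_of_ae hg)
    rw [integral_sub hf (integrable_const c), integral_const, smul_eq_mul, probReal_univ, one_mul]
    linarith
  filter_upwards [(integral_eq_zero_iff_of_nonneg_ae hg hgi).1 h0] with ω hω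
  have h1 : f ω - c = 0 := hω
  linarith

/-! ## Per-sample conclusion -/

/-- **From "root energy `= hcpE a₀ h₀` at every atom" to hcp.** If every re-rooting of
`count|(A '' barlowStacking a₀ h₀ s)` at an atom has root energy `hcpE a₀ h₀`, then (re-rooting at
`A (barlowPos a₀ h₀ s k 0 0)`, whose root energy is the site energy of layer `k`) no layer is cubic, so
`s = ± alternatingHagg` and the carrier is `A' '' hcpStacking a₀ h₀` with `A' = A` or `A ∘ (−id)`.
[folklore] -/
theorem exists_eq_hcp_of_forall_atoms {a₀ h₀ : ℝ} (ha₁ : 189 / 200 ≤ a₀) (ha₂ : a₀ ≤ 199 / 200)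
    (hh₁ : 77 / 100 ≤ h₀) (hh₂ : h₀ ≤ 163 / 200)
    (hmin : ∀ a h : ℝ, 0 < a → 0 < h → hcpE a₀ h₀ ≤ hcpE a h)
    (A : EuclideanSpace ℝ (Fin 3) ≃ₗᵢ[ℝ] EuclideanSpace ℝ (Fin 3)) {s : ℤ → ℤ} (hs : IsHaggSeq s)
    (hall : ∀ y : EuclideanSpace ℝ (Fin 3),
      (Measure.count : Measure (EuclideanSpace ℝ (Fin 3))).restrict
          (A '' barlowStacking a₀ h₀ s) {y} ≠ 0 →
        (∫ z, lennardJones ‖z‖ ∂Measure.map (fun z => z - y)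
          ((Measure.count : Measure (EuclideanSpace ℝ (Fin 3))).restrict
            (A '' barlowStacking a₀ h₀ s))) / 2 = hcpE a₀ h₀) :
    ∃ A' : EuclideanSpace ℝ (Fin 3) ≃ₗᵢ[ℝ] EuclideanSpace ℝ (Fin 3),
      (Measure.count : Measure (EuclideanSpace ℝ (Fin 3))).restrict (A '' barlowStacking a₀ h₀ s) =
        (Measure.count : Measure (EuclideanSpace ℝ (Fin 3))).restrict (A' '' hcpStacking a₀ h₀) := by
  have ha0 : 0 < a₀ := by linarith
  have hh0 : 0 < h₀ := by linarith
  -- no cubic layer anywhere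
  have hk : ∀ k : ℤ, s k = -s (k - 1) := by
    intro k
    have hy : (Measure.count : Measure (EuclideanSpace ℝ (Fin 3))).restrict
        (A '' barlowStacking a₀ h₀ s) {A (barlowPos a₀ h₀ s (k - 1) 0 0)} ≠ 0 :=
      (count_restrict_singleton_ne_zero_iff _ _).2
        (Set.mem_image_of_mem A (barlowPos_mem (k - 1) 0 0))
    have h1 := hall _ hy
    rw [map_sub_count_restrict, rootEnergy_reroot_eq_barlowSiteEnergy ha0 hh0 s A (k - 1) 0 0] at h1
    have hne := (selection_at_site ha₁ ha₂ hh₁ hh₂ hmin (Or.inl rfl) hs (k - 1) h1.le).2.1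
    rw [sub_add_cancel] at hne
    rcases hs k with h2 | h2 <;> rcases hs (k - 1) with h3 | h3 <;> rw [h2, h3] at hne ⊢ <;> omega
  rcases eq_alternating_or_neg_of_forall hs hk with halt | halt
  · obtain rfl : s = alternatingHagg := funext halt
    exact ⟨A, rfl⟩
  · obtain rfl : s = fun m => -alternatingHagg m := funext halt
    refine ⟨(LinearIsometryEquiv.neg ℝ).trans A, ?_⟩
    rw [← (bijOn_neg_hcpStacking a₀ h₀).image_eq, hcpStacking, LinearIsometryEquiv.coe_trans,
      Set.image_comp, LinearIsometryEquiv.coe_neg]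

/-! ## The stub -/

/-- **X3 `stub_exactSelectionLaw`: SELECTION AT EXACT GEOMETRY.** For the relaxed reference `(a₀, h₀)`
(box + global `hcpE`-minimality), a point-stationary probability law on rooted `δ`-hard-core
configurations which is a.s. the counting measure of a rotated exact stacking `A '' barlowStacking a₀ h s`
with `h ∈ {h₀, a₀ √(2/3)}`, `s` a Hägg word, and whose mean root energy is `≤ hcpE a₀ h₀`, is a.s. a
rotated `hcpStacking a₀ h₀`.  Proof: the root energy of such a sample is `barlowSiteEnergy … s 0 ≥ hcpE a₀ h₀`
(root energy identity + column + global minimality); the level `hcpE a₀ h₀ < 0` is not the junk value,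
so the mean ceiling forces a.s. equality; Aldous–Lyons transports the equality to every atom (hard-core
configurations are locally finite); at the atom `A (barlowPos a₀ h₀ s k 0 0)` the root energy is the site
energy of layer `k`, so `h = h₀`, no layer is cubic, `s = ± alternatingHagg`, and the sign is a point
reflection. [folklore] -/
theorem stub_exactSelectionLaw :
    ∀ a₀ h₀ : ℝ, 189 / 200 ≤ a₀ → a₀ ≤ 199 / 200 → 77 / 100 ≤ h₀ → h₀ ≤ 163 / 200 →
      (∀ a h : ℝ, 0 < a → 0 < h →
        Summit.AtomisticToContinuum.Crystallization.Theorems.PalmUnimodularRigidity.LayeredLawsSelectHcp.hcpE a₀ h₀ ≤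
          Summit.AtomisticToContinuum.Crystallization.Theorems.PalmUnimodularRigidity.LayeredLawsSelectHcp.hcpE a h) →
      ∀ δ : ℝ, 0 < δ → ∀ P : Measure (Measure (EuclideanSpace ℝ (Fin 3))), IsProbabilityMeasure P →
        (∀ᵐ μ ∂P, IsRootedHardCore δ μ) → IsPointStationaryLaw P →
        (∫ μ, (∫ y, lennardJones ‖y‖ ∂μ) / 2 ∂P) ≤
          Summit.AtomisticToContinuum.Crystallization.Theorems.PalmUnimodularRigidity.LayeredLawsSelectHcp.hcpE a₀ h₀ →
        (∀ᵐ μ ∂P, ∃ A : EuclideanSpace ℝ (Fin 3) ≃ₗᵢ[ℝ] EuclideanSpace ℝ (Fin 3), ∃ h : ℝ,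
          (h = h₀ ∨ h = a₀ * Real.sqrt (2 / 3)) ∧ ∃ s : ℤ → ℤ, IsHaggSeq s ∧
            μ = (Measure.count : Measure (EuclideanSpace ℝ (Fin 3))).restrict (A '' barlowStacking a₀ h s)) →
        ∀ᵐ μ ∂P, ∃ A : EuclideanSpace ℝ (Fin 3) ≃ₗᵢ[ℝ] EuclideanSpace ℝ (Fin 3),
          μ = (Measure.count : Measure (EuclideanSpace ℝ (Fin 3))).restrict (A '' hcpStacking a₀ h₀) := by
  intro a₀ h₀ ha₁ ha₂ hh₁ hh₂ hmin δ hδ P hP hHC hstat hEn hcar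
  have ha0 : 0 < a₀ := by linarith
  have hc : hcpE a₀ h₀ < 0 := hcpE_neg_of_isMin hmin
  -- (1)+(2): a.s. the root energy is at least the level
  have hge : ∀ᵐ μ ∂P, hcpE a₀ h₀ ≤ (∫ y, lennardJones ‖y‖ ∂μ) / 2 := by
    filter_upwards [hcar] with μ hμ
    obtain ⟨A, h, hh, s, hs, rfl⟩ := hμ
    obtain ⟨hpos, hlo, hhi⟩ := column_box ha₁ ha₂ hh₁ hh₂ hmin hh
    rw [rootEnergy_eq_barlowSiteEnergy_zero ha0 hpos s A]
    obtain ⟨hJ, hcolumn⟩ :=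
      SiteColumnLJ.stub_siteColumnLJ a₀ h (by linarith) (by linarith) hlo hhi
    have h1 := hcolumn s hs 0
    have h2 := hmin a₀ h ha0 hpos
    have hI₁ : (0 : ℝ) ≤ (if s (0 + 1) = s 0 then 1 else 0) := by split_ifs <;> norm_num
    have hI₂ : (0 : ℝ) ≤ (if s (0 - 1) = s (0 - 2) then 1 else 0) := by split_ifs <;> norm_num
    have h3 : 0 ≤ 1 / 2 * (barlowCoupling lennardJones a₀ h 3 - barlowCoupling lennardJones a₀ h 2) *
        ((if s (0 + 1) = s 0 then 1 else 0) + (if s (0 - 1) = s (0 - 2) then 1 else 0) : ℝ) :=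
      mul_nonneg (by linarith) (by linarith)
    linarith
  -- (3): the level is not junk, so a.s. equality at the root
  have hae : ∀ᵐ μ ∂P, (∫ y, lennardJones ‖y‖ ∂μ) / 2 = hcpE a₀ h₀ :=
    ae_eq_const_of_integral_le hc hge hEn
  -- (5): hard-core configurations are locally finite; Aldous–Lyons
  have hlf : ∀ᵐ μ ∂P, ∀ n : ℕ, μ ((fun z : EuclideanSpace ℝ (Fin 3) => ⌊‖z‖⌋₊) ⁻¹' {n}) < ⊤ := by
    filter_upwards [hHC] with μ hμ
    obtain ⟨S, -, hsep, rfl⟩ := hμ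
    exact fun n => PalmUnimodularRigidity.count_restrict_floorNorm_preimage_lt_top hδ hsep n
  have hevery : ∀ᵐ μ ∂P, ∀ y : EuclideanSpace ℝ (Fin 3), μ {y} ≠ 0 →
      (∫ z, lennardJones ‖z‖ ∂Measure.map (fun z => z - y) μ) / 2 = hcpE a₀ h₀ :=
    PalmUnimodularRigidity.ae_forall_map_sub_of_ae
      (p := fun ν => (∫ z, lennardJones ‖z‖ ∂ν) / 2 = hcpE a₀ h₀) hstat hlf hae
  -- (4): conclude sample by sample
  filter_upwards [hcar, hae, hevery] with μ hrep hroot hall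
  obtain ⟨A, h, hh, s, hs, rfl⟩ := hrep
  rw [rootEnergy_eq_barlowSiteEnergy_zero ha0 (column_box ha₁ ha₂ hh₁ hh₂ hmin hh).1 s A] at hroot
  have hhh : h = h₀ := (selection_at_site ha₁ ha₂ hh₁ hh₂ hmin hh hs 0 hroot.le).1
  rw [hhh] at hall ⊢
  exact exists_eq_hcp_of_forall_atoms ha₁ ha₂ hh₁ hh₂ hmin A hs hall

end Summit.AtomisticToContinuum.Crystallization.Theorems.PalmGoodLaw.ExactSelectionLaw

end
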